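import Mathlib.Geometry.Manifold.Riemannian.Basic
import Mathlib.Geometry.Manifold.Diffeomorph
import Mathlib.Geometry.Euclidean.Volume.Measure
import Literature.Geometry.Lorentzian.Volume
import Literature.Geometry.Lorentzian.Isometry
import Literature.Geometry.Riemannian.RiemannianDistance
import HarnessLib

/-!
# Isometries preserve arc length, the Riemannian distance and the Riemannian volume

Companion of `Volume.lean` (the Riemannian volume `riemannianVolume h d = μHE[d]` and the
Riemannian measure `riemannianMeasure h = riemannianVolume h (dim)` of the length metric
`riemannianEDist` of a Riemannian metric `h`) and of `Isometry.lean` (`IsIsometry gN gM Φ`: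
`Φ^* gM = gN` for a diffeomorphism `Φ`). The tree so far had the invariance of distance and
volume only for the transport of ONE metric to another model structure on the same manifold
(`Literature/Geometry/Riemannian/ModelTransportMetric.lean`); this file proves it for an
arbitrary `C^m` diffeomorphism `Φ : N ≃ M` (`m ≠ 0`) between two manifolds whose differential
preserves the norms of tangent vectors, `h_M(dΦ v, dΦ v) = h_N(v, v)` — an isometry in the sense
of O'Neill 1983, Ch. 3, Def. 3.4:

* `pathELength_comp_le`, `pathELength_comp_eq` — a map whose differential does not increase
  (preserves) norms does not increase (preserves) the arc length of curves (chain rule);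
* `riemannianEDist_comp_le` — `C¹` maps with norm-nonincreasing differential are `1`-Lipschitz
  for Mathlib's length distance `riemannianEDist` (infimum of lengths of `C¹` paths);
  `Diffeomorph.riemannianEDist_symm_le`, `Diffeomorph.riemannianEDist_eq` — a diffeomorphism
  with norm-preserving differential preserves `riemannianEDist` (O'Neill 1983, Ch. 5, Def. 15
  ff.; Lee 2018, Prop. 2.51: isometries preserve lengths of curves and the Riemannian distance);
* `Diffeomorph.riemannianVolume_image_eq` (`Vol^d_{h_M}(Φ s) = Vol^d_{h_N}(s)` in every
  dimension `d`), `…_preimage_eq`, `Diffeomorph.map_riemannianVolume`,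
  `Diffeomorph.measurePreserving_riemannianVolume`, `Diffeomorph.lintegral_comp_riemannianVolume`,
  `Diffeomorph.setLIntegral_comp_riemannianVolume` — `Φ` is an isometry of the two length
  structures, and isometries preserve (Euclidean-normalised) Hausdorff measures (Federer 1969,
  §2.10.11; Mathlib's `Isometry.euclideanHausdorffMeasure_image`);
* `Diffeomorph.finrank_model_eq` (a diffeomorphism with nonempty source forces equal model
  dimensions) and the same list for the Riemannian measure `riemannianMeasure`
  (`Diffeomorph.riemannianMeasure_image_eq`, `…_preimage_eq`, `Diffeomorph.map_riemannianMeasure`,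
  `Diffeomorph.measurePreserving_riemannianMeasure`,
  `Diffeomorph.lintegral_comp_riemannianMeasure`, `Diffeomorph.setLIntegral_comp_riemannianMeasure`,
  `Diffeomorph.setLIntegral_comp_riemannianMeasure'`) — the change-of-variables formula
  `∫ f ∘ Φ dV_{h_N} = ∫ f dV_{h_M}` along an isometry (Lee 2018, Prop. 2.51 with Prop. 2.41 ff.;
  Chavel 2006, §III.3);
* in the vocabulary of `Isometry.lean`: `IsIsometry.val_mfderiv_mfderiv`,
  `IsIsometry.isRiemannian` (the source of an isometry onto a Riemannian manifold is
  Riemannian), `IsIsometry.edist_eq` (`PseudoRiemannianMetric.edist` of `RiemannianDistance.lean`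
  is preserved), `IsIsometry.riemannianMeasure_image_eq`,
  `IsIsometry.measurePreserving_riemannianMeasure` (for the Mathlib metrics
  `g.toContMDiffRiemannianMetric`, to which `g.riemVolume` unfolds by `riemVolume_eq`).

Everything is proved; no definitions and no named facts are introduced. (Motivation: Bray 2001,
§6, proof of Thm. 9, (94): the smoothed double `(M̃_{Σ,δ}, ḡ_δ)` "has two regions which are
isometric to `(M³_Σ, g)`", through which Dirichlet energies and capacities are transferred.)

## References

* B. O'Neill, *Semi-Riemannian Geometry with Applications to Relativity*, Academic Press 1983,
  Ch. 3, Def. 3.4 (p. 58) (isometries), Ch. 5, Def. 11 (arc length) and Def. 15 ff. (p. 134)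
  (Riemannian distance; isometries preserve it). [ONeill1983]
* J. M. Lee, *Introduction to Riemannian Manifolds*, 2nd ed., Springer 2018, Prop. 2.51
  (isometries preserve lengths, distances and the Riemannian volume), Prop. 2.41 ff. [Lee2018]
* H. Federer, *Geometric Measure Theory*, Springer 1969, §2.10.11 (isometries and Lipschitz
  maps vs. Hausdorff measures), §3.2.46 (Hausdorff measure of a Riemannian manifold). [Federer1969]
* I. Chavel, *Riemannian Geometry: A Modern Introduction*, 2nd ed., CUP 2006, §III.3. [Chavel2006]
* H. L. Bray, *Proof of the Riemannian Penrose inequality using the positive mass theorem*,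
  J. Differential Geom. 59 (2001) 177–267, §6, proof of Thm. 9, (94). [BrayRPI2001]
-/

noncomputable section

open Manifold Bundle MeasureTheory Measure Set Filter Function Module
open scoped ContDiff Topology ENNReal NNReal

namespace Literature.Geometry.Lorentzian

variable {E : Type*} [NormedAddCommGroup E] [NormedSpace ℝ E]
  {H : Type*} [TopologicalSpace H] {I : ModelWithCorners ℝ E H}
  {M : Type*} [TopologicalSpace M] [ChartedSpace H M]
  {E' : Type*} [NormedAddCommGroup E'] [NormedSpace ℝ E']
  {H' : Type*} [TopologicalSpace H'] {I' : ModelWithCorners ℝ E' H'}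
  {N : Type*} [TopologicalSpace N] [ChartedSpace H' N]

/-! ### Arc length under maps with norm-nonincreasing / norm-preserving differential -/

section PathLength

variable [RiemannianBundle (fun x : M ↦ TangentSpace I x)]
  [RiemannianBundle (fun x : N ↦ TangentSpace I' x)]

/-- **A map whose differential does not increase norms does not increase arc length**: if
`γ : ℝ → N` is differentiable on `(a, b)`, `Φ : N → M` is differentiable along `γ` and
`‖dΦ_{γ t} v‖ ≤ ‖v‖` for `t ∈ (a, b)`, then `L(Φ ∘ γ|[a,b]) ≤ L(γ|[a,b])` (chain rule
`(Φ ∘ γ)' = dΦ(γ')` on `(a, b)`; the endpoints are null). O'Neill 1983, Ch. 3, p. 58 and Ch. 5,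
Def. 11 (isometries preserve the speed, hence the arc length, of curves). [folklore] -/
theorem pathELength_comp_le {Φ : N → M} {γ : ℝ → N} {a b : ℝ}
    (hΦ : ∀ t ∈ Ioo a b, MDifferentiableAt I' I Φ (γ t))
    (hγ : ∀ t ∈ Ioo a b, MDifferentiableAt 𝓘(ℝ, ℝ) I' γ t)
    (hle : ∀ t ∈ Ioo a b, ∀ v : TangentSpace I' (γ t), ‖mfderiv I' I Φ (γ t) v‖ ≤ ‖v‖) :
    pathELength I (Φ ∘ γ) a b ≤ pathELength I' γ a b := by
  simp only [pathELength_eq_lintegral_mfderiv_Ioo]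
  refine setLIntegral_mono' measurableSet_Ioo fun t ht ↦ ?_
  rw [mfderiv_comp_apply t (hΦ t ht) (hγ t ht), ← ofReal_norm, ← ofReal_norm]
  exact ENNReal.ofReal_le_ofReal (hle t ht _)

/-- **A map whose differential preserves norms preserves arc length**: if `γ : ℝ → N` is
differentiable on `(a, b)`, `Φ : N → M` is differentiable along `γ` and `‖dΦ_{γ t} v‖ = ‖v‖` for
`t ∈ (a, b)`, then `L(Φ ∘ γ|[a,b]) = L(γ|[a,b])`. O'Neill 1983, Ch. 5, Def. 11 and Ch. 3, p. 58
("isometries preserve arc length"); Lee 2018, Prop. 2.51. [folklore] -/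
theorem pathELength_comp_eq {Φ : N → M} {γ : ℝ → N} {a b : ℝ}
    (hΦ : ∀ t ∈ Ioo a b, MDifferentiableAt I' I Φ (γ t))
    (hγ : ∀ t ∈ Ioo a b, MDifferentiableAt 𝓘(ℝ, ℝ) I' γ t)
    (heq : ∀ t ∈ Ioo a b, ∀ v : TangentSpace I' (γ t), ‖mfderiv I' I Φ (γ t) v‖ = ‖v‖) :
    pathELength I (Φ ∘ γ) a b = pathELength I' γ a b := by
  simp only [pathELength_eq_lintegral_mfderiv_Ioo]
  refine setLIntegral_congr_fun measurableSet_Ioo fun t ht ↦ ?_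
  rw [mfderiv_comp_apply t (hΦ t ht) (hγ t ht), ← ofReal_norm, ← ofReal_norm]
  exact congrArg ENNReal.ofReal (heq t ht _)

/-! ### The Riemannian distance -/

/-- **`C¹` maps with norm-nonincreasing differential are `1`-Lipschitz for the Riemannian
(length) distance**: `d_M(Φ x, Φ y) ≤ d_N(x, y)` — every `C¹` path from `x` to `y` of length
`< r` is mapped to a `C¹` path from `Φ x` to `Φ y` of length `< r` (`pathELength_comp_le`).
O'Neill 1983, Ch. 5, Def. 15 ff.; Burago–Burago–Ivanov 2001, §5.1. [folklore] -/
theorem riemannianEDist_comp_le {Φ : N → M} (hΦ : ContMDiff I' I 1 Φ)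
    (hle : ∀ x (v : TangentSpace I' x), ‖mfderiv I' I Φ x v‖ ≤ ‖v‖) (x y : N) :
    riemannianEDist I (Φ x) (Φ y) ≤ riemannianEDist I' x y := by
  refine le_of_forall_gt_imp_ge_of_dense fun r hr ↦ ?_
  obtain ⟨γ, hγ0, hγ1, hγ, hlen⟩ := exists_lt_of_riemannianEDist_lt hr
  have hΦγ : ContMDiffOn 𝓘(ℝ, ℝ) I 1 (Φ ∘ γ) (Icc 0 1) := hΦ.comp_contMDiffOn hγ
  calc riemannianEDist I (Φ x) (Φ y) ≤ pathELength I (Φ ∘ γ) 0 1 :=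
        riemannianEDist_le_pathELength hΦγ (by simp [hγ0]) (by simp [hγ1]) zero_le_one
    _ ≤ pathELength I' γ 0 1 := by
        refine pathELength_comp_le (fun t _ ↦ (hΦ (γ t)).mdifferentiableAt one_ne_zero)
          (fun t ht ↦ ?_) (fun t _ v ↦ hle _ v)
        exact ((hγ t (Ioo_subset_Icc_self ht)).contMDiffAt
          (Icc_mem_nhds ht.1 ht.2)).mdifferentiableAt one_ne_zero
    _ ≤ r := hlen.le

/-- **The inverse of a diffeomorphism with norm-preserving differential is `1`-Lipschitz for
the Riemannian distance**: `d_N(Φ⁻¹ p, Φ⁻¹ q) ≤ d_M(p, q)` — a `C¹` path `γ` from `p` to `q` gives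
the `C¹` path `Φ⁻¹ ∘ γ` from `Φ⁻¹ p` to `Φ⁻¹ q`, whose length is that of `Φ ∘ Φ⁻¹ ∘ γ = γ`
(`pathELength_comp_eq`). O'Neill 1983, Ch. 5, Def. 15 ff. [folklore] -/
theorem Diffeomorph.riemannianEDist_symm_le {n : ℕ∞ω} (Φ : Diffeomorph I' I N M n) (hn : n ≠ 0)
    (heq : ∀ x (v : TangentSpace I' x), ‖mfderiv I' I Φ x v‖ = ‖v‖) (p q : M) :
    riemannianEDist I' (Φ.symm p) (Φ.symm q) ≤ riemannianEDist I p q := by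
  have h1 : (1 : ℕ∞ω) ≤ n := ENat.one_le_iff_ne_zero_withTop.mpr hn
  refine le_of_forall_gt_imp_ge_of_dense fun r hr ↦ ?_
  obtain ⟨γ, hγ0, hγ1, hγ, hlen⟩ := exists_lt_of_riemannianEDist_lt hr
  have hΨγ : ContMDiffOn 𝓘(ℝ, ℝ) I' 1 (Φ.symm ∘ γ) (Icc 0 1) :=
    (Φ.symm.contMDiff.of_le h1).comp_contMDiffOn hγ
  have hγd : ∀ t ∈ Ioo (0 : ℝ) 1, MDifferentiableAt 𝓘(ℝ, ℝ) I γ t := fun t ht ↦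
    ((hγ t (Ioo_subset_Icc_self ht)).contMDiffAt (Icc_mem_nhds ht.1 ht.2)).mdifferentiableAt
      one_ne_zero
  have hΨγd : ∀ t ∈ Ioo (0 : ℝ) 1, MDifferentiableAt 𝓘(ℝ, ℝ) I' (Φ.symm ∘ γ) t := fun t ht ↦
    ((hΨγ t (Ioo_subset_Icc_self ht)).contMDiffAt (Icc_mem_nhds ht.1 ht.2)).mdifferentiableAt
      one_ne_zero
  calc riemannianEDist I' (Φ.symm p) (Φ.symm q) ≤ pathELength I' (Φ.symm ∘ γ) 0 1 :=
        riemannianEDist_le_pathELength hΨγ (by simp [hγ0]) (by simp [hγ1]) zero_le_one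
    _ = pathELength I (Φ ∘ (Φ.symm ∘ γ)) 0 1 :=
        (pathELength_comp_eq (fun t _ ↦ Φ.mdifferentiable hn _) hΨγd (fun t _ v ↦ heq _ v)).symm
    _ = pathELength I γ 0 1 := by
        refine pathELength_congr fun t _ ↦ ?_
        simp only [Function.comp_apply, Diffeomorph.apply_symm_apply]
    _ ≤ r := hlen.le

/-- **Diffeomorphisms whose differential preserves norms preserve the Riemannian distance**:
`d_M(Φ x, Φ y) = d_N(x, y)` for a `C^n` diffeomorphism `Φ : N ≃ M`, `n ≥ 1`, with
`‖dΦ_x v‖ = ‖v‖` (both `Φ` and `Φ⁻¹` are `1`-Lipschitz, `riemannianEDist_comp_le`,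
`Diffeomorph.riemannianEDist_symm_le`). O'Neill 1983, Ch. 5, Def. 15 ff. ("isometries
preserve Riemannian distance"); Lee 2018, Prop. 2.51. [folklore] -/
theorem Diffeomorph.riemannianEDist_eq {n : ℕ∞ω} (Φ : Diffeomorph I' I N M n) (hn : n ≠ 0)
    (heq : ∀ x (v : TangentSpace I' x), ‖mfderiv I' I Φ x v‖ = ‖v‖) (x y : N) :
    riemannianEDist I (Φ x) (Φ y) = riemannianEDist I' x y := by
  have h1 : (1 : ℕ∞ω) ≤ n := ENat.one_le_iff_ne_zero_withTop.mpr hn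
  refine le_antisymm
    (riemannianEDist_comp_le (Φ.contMDiff.of_le h1) (fun x v ↦ (heq x v).le) x y) ?_
  have h := Diffeomorph.riemannianEDist_symm_le Φ hn heq (Φ x) (Φ y)
  rwa [Φ.symm_apply_apply, Φ.symm_apply_apply] at h

end PathLength

/-! ### Equidimensionality -/

/-- A `C^m` diffeomorphism (`m ≠ 0`) with nonempty source forces equal model dimensions
(its differential at a point is a linear isomorphism `E' ≃ E`). [folklore] -/
theorem Diffeomorph.finrank_model_eq {m : ℕ∞ω} (Φ : Diffeomorph I' I N M m) (hm : m ≠ 0)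
    [Nonempty N] : finrank ℝ E' = finrank ℝ E := by
  obtain ⟨x⟩ := ‹Nonempty N›
  exact (Φ.mfderivToContinuousLinearEquiv hm x).toLinearEquiv.finrank_eq


/-! ### The Riemannian volume -/

section Norm

variable {n : ℕ∞ω} [IsManifold I 1 M]
  (hM : ContMDiffRiemannianMetric I n E (TangentSpace I : M → Type _))

/-- Under the Riemannian bundle structure of a `ContMDiffRiemannianMetric` `h`, the norm of a
tangent vector is `√(h(v, v))`. [folklore] -/
theorem norm_eq_sqrt_inner_of_riemannianMetric (x : M) (v : TangentSpace I x) :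
    (letI : RiemannianBundle (fun x : M ↦ TangentSpace I x) :=
        ⟨hM.toContinuousRiemannianMetric.toRiemannianMetric⟩;
      ‖v‖) = Real.sqrt (hM.inner x v v) := by
  letI : RiemannianBundle (fun x : M ↦ TangentSpace I x) :=
    ⟨hM.toContinuousRiemannianMetric.toRiemannianMetric⟩
  rw [@norm_eq_sqrt_re_inner ℝ (TangentSpace I x)]
  rfl

end Norm

section Volume

variable {n n' : ℕ∞ω} [IsManifold I 1 M] [T3Space M] [MeasurableSpace M] [BorelSpace M]
  [IsManifold I' 1 N] [T3Space N] [MeasurableSpace N] [BorelSpace N]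
  {hN : ContMDiffRiemannianMetric I' n' E' (TangentSpace I' : N → Type _)}
  {hM : ContMDiffRiemannianMetric I n E (TangentSpace I : M → Type _)}

/-- **Isometric diffeomorphisms preserve the Riemannian volume** (in every dimension `d`): if
`Φ : N ≃ M` is a `C^n` diffeomorphism (`n ≥ 1`) with `h_M(dΦ v, dΦ v) = h_N(v, v)`, then
`Vol^d_{h_M}(Φ(s)) = Vol^d_{h_N}(s)` for every `s ⊆ N`. Both sides are Euclidean-normalised
`d`-dimensional Hausdorff measures of length distances (`Volume.lean`), `Φ` is an isometry of the
two length structures (`Diffeomorph.riemannianEDist_eq`), and isometries preserve Hausdorff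
measures (Federer 1969, §2.10.11; Mathlib's `Isometry.euclideanHausdorffMeasure_image`).
[cite: Federer1969, §2.10.11] -/
theorem Diffeomorph.riemannianVolume_image_eq {m : ℕ∞ω} (Φ : Diffeomorph I' I N M m) (hm : m ≠ 0)
    (hiso : ∀ x (v : TangentSpace I' x),
      hM.inner (Φ x) (mfderiv I' I Φ x v) (mfderiv I' I Φ x v) = hN.inner x v v)
    (d : ℕ) (s : Set N) :
    riemannianVolume hM d (Φ '' s) = riemannianVolume hN d s := by
  letI iN : RiemannianBundle (fun x : N ↦ TangentSpace I' x) :=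
    ⟨hN.toContinuousRiemannianMetric.toRiemannianMetric⟩
  letI iM : RiemannianBundle (fun x : M ↦ TangentSpace I x) :=
    ⟨hM.toContinuousRiemannianMetric.toRiemannianMetric⟩
  let mN : EMetricSpace N := EMetricSpace.ofRiemannianMetric I' N
  let mM : EMetricSpace M := EMetricSpace.ofRiemannianMetric I M
  have heq : ∀ x (v : TangentSpace I' x), ‖mfderiv I' I Φ x v‖ = ‖v‖ := by
    intro x v
    rw [norm_eq_sqrt_inner_of_riemannianMetric hM, norm_eq_sqrt_inner_of_riemannianMetric hN,
      hiso x v]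
  have hI : @Isometry N M mN.toPseudoEMetricSpace mM.toPseudoEMetricSpace Φ := fun x y ↦
    Diffeomorph.riemannianEDist_eq Φ hm heq x y
  have h := @Isometry.euclideanHausdorffMeasure_image N M mN _ _ mM _ _ Φ d hI s
  exact h

/-- **Isometric diffeomorphisms preserve the Riemannian volume**, preimage form:
`Vol^d_{h_N}(Φ⁻¹(A)) = Vol^d_{h_M}(A)`. [cite: Federer1969, §2.10.11] -/
theorem Diffeomorph.riemannianVolume_preimage_eq {m : ℕ∞ω} (Φ : Diffeomorph I' I N M m)
    (hm : m ≠ 0)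
    (hiso : ∀ x (v : TangentSpace I' x),
      hM.inner (Φ x) (mfderiv I' I Φ x v) (mfderiv I' I Φ x v) = hN.inner x v v)
    (d : ℕ) (A : Set M) :
    riemannianVolume hN d (Φ ⁻¹' A) = riemannianVolume hM d A := by
  rw [← Diffeomorph.riemannianVolume_image_eq Φ hm hiso d,
    Set.image_preimage_eq A fun y ↦ ⟨Φ.symm y, Φ.apply_symm_apply y⟩]

/-- **Isometric diffeomorphisms push the Riemannian volume forward to the Riemannian volume**:
`Φ_* Vol^d_{h_N} = Vol^d_{h_M}`. [cite: Federer1969, §2.10.11] -/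
theorem Diffeomorph.map_riemannianVolume {m : ℕ∞ω} (Φ : Diffeomorph I' I N M m) (hm : m ≠ 0)
    (hiso : ∀ x (v : TangentSpace I' x),
      hM.inner (Φ x) (mfderiv I' I Φ x v) (mfderiv I' I Φ x v) = hN.inner x v v) (d : ℕ) :
    (riemannianVolume hN d).map Φ = riemannianVolume hM d := by
  refine Measure.ext fun A hA ↦ ?_
  rw [Measure.map_apply Φ.continuous.measurable hA,
    Diffeomorph.riemannianVolume_preimage_eq Φ hm hiso]

/-- **Isometric diffeomorphisms are measure preserving** for the Riemannian volumes.
[cite: Federer1969, §2.10.11] -/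
theorem Diffeomorph.measurePreserving_riemannianVolume {m : ℕ∞ω} (Φ : Diffeomorph I' I N M m)
    (hm : m ≠ 0)
    (hiso : ∀ x (v : TangentSpace I' x),
      hM.inner (Φ x) (mfderiv I' I Φ x v) (mfderiv I' I Φ x v) = hN.inner x v v) (d : ℕ) :
    MeasurePreserving Φ (riemannianVolume hN d) (riemannianVolume hM d) :=
  ⟨Φ.continuous.measurable, Diffeomorph.map_riemannianVolume Φ hm hiso d⟩

/-- **Change of variables in integrals along an isometric diffeomorphism**:
`∫⁻ f ∘ Φ dVol_{h_N} = ∫⁻ f dVol_{h_M}` for every `f : M → ℝ≥0∞` (no measurability needed: `Φ`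
is a measurable equivalence). [cite: Federer1969, §2.10.11] -/
theorem Diffeomorph.lintegral_comp_riemannianVolume {m : ℕ∞ω} (Φ : Diffeomorph I' I N M m)
    (hm : m ≠ 0)
    (hiso : ∀ x (v : TangentSpace I' x),
      hM.inner (Φ x) (mfderiv I' I Φ x v) (mfderiv I' I Φ x v) = hN.inner x v v)
    (d : ℕ) (f : M → ℝ≥0∞) :
    ∫⁻ x, f (Φ x) ∂(riemannianVolume hN d) = ∫⁻ y, f y ∂(riemannianVolume hM d) :=
  (Diffeomorph.measurePreserving_riemannianVolume Φ hm hiso d).lintegral_comp_emb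
    Φ.toHomeomorph.measurableEmbedding f

/-- **Change of variables over a set**: `∫⁻_{Φ⁻¹ A} f ∘ Φ dVol_{h_N} = ∫⁻_A f dVol_{h_M}`.
[cite: Federer1969, §2.10.11] -/
theorem Diffeomorph.setLIntegral_comp_riemannianVolume {m : ℕ∞ω} (Φ : Diffeomorph I' I N M m)
    (hm : m ≠ 0)
    (hiso : ∀ x (v : TangentSpace I' x),
      hM.inner (Φ x) (mfderiv I' I Φ x v) (mfderiv I' I Φ x v) = hN.inner x v v)
    (d : ℕ) (f : M → ℝ≥0∞) (A : Set M) :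
    ∫⁻ x in Φ ⁻¹' A, f (Φ x) ∂(riemannianVolume hN d) = ∫⁻ y in A, f y ∂(riemannianVolume hM d) :=
  (Diffeomorph.measurePreserving_riemannianVolume Φ hm hiso d).setLIntegral_comp_preimage_emb
    Φ.toHomeomorph.measurableEmbedding f A

/-! ### The Riemannian measure (top dimension) -/

/-- **Isometric diffeomorphisms preserve the Riemannian measure** `dV` (the Riemannian volume
in the top dimension; the model dimensions agree, `Diffeomorph.finrank_model_eq`):
`dV_{h_M}(Φ(s)) = dV_{h_N}(s)`. Federer 1969, §2.10.11 with §3.2.46; Lee 2018, Prop. 2.51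
with Prop. 2.41 ff. [cite: Federer1969, §2.10.11] -/
theorem Diffeomorph.riemannianMeasure_image_eq {m : ℕ∞ω} (Φ : Diffeomorph I' I N M m)
    (hm : m ≠ 0)
    (hiso : ∀ x (v : TangentSpace I' x),
      hM.inner (Φ x) (mfderiv I' I Φ x v) (mfderiv I' I Φ x v) = hN.inner x v v)
    (s : Set N) :
    riemannianMeasure hM (Φ '' s) = riemannianMeasure hN s := by
  cases isEmpty_or_nonempty N with
  | inl h => simp [Set.eq_empty_of_isEmpty s]
  | inr h =>
    unfold riemannianMeasure
    rw [Diffeomorph.finrank_model_eq Φ hm]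
    exact Diffeomorph.riemannianVolume_image_eq Φ hm hiso _ s

/-- Preimage form: `dV_{h_N}(Φ⁻¹(A)) = dV_{h_M}(A)`. [cite: Federer1969, §2.10.11] -/
theorem Diffeomorph.riemannianMeasure_preimage_eq {m : ℕ∞ω} (Φ : Diffeomorph I' I N M m)
    (hm : m ≠ 0)
    (hiso : ∀ x (v : TangentSpace I' x),
      hM.inner (Φ x) (mfderiv I' I Φ x v) (mfderiv I' I Φ x v) = hN.inner x v v)
    (A : Set M) :
    riemannianMeasure hN (Φ ⁻¹' A) = riemannianMeasure hM A := by
  rw [← Diffeomorph.riemannianMeasure_image_eq Φ hm hiso,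
    Set.image_preimage_eq A fun y ↦ ⟨Φ.symm y, Φ.apply_symm_apply y⟩]

/-- Push-forward form: `Φ_* dV_{h_N} = dV_{h_M}`. [cite: Federer1969, §2.10.11] -/
theorem Diffeomorph.map_riemannianMeasure {m : ℕ∞ω} (Φ : Diffeomorph I' I N M m) (hm : m ≠ 0)
    (hiso : ∀ x (v : TangentSpace I' x),
      hM.inner (Φ x) (mfderiv I' I Φ x v) (mfderiv I' I Φ x v) = hN.inner x v v) :
    (riemannianMeasure hN).map Φ = riemannianMeasure hM := by
  refine Measure.ext fun A hA ↦ ?_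
  rw [Measure.map_apply Φ.continuous.measurable hA,
    Diffeomorph.riemannianMeasure_preimage_eq Φ hm hiso]

/-- **Isometric diffeomorphisms are measure preserving** for the Riemannian measures.
[cite: Federer1969, §2.10.11] -/
theorem Diffeomorph.measurePreserving_riemannianMeasure {m : ℕ∞ω} (Φ : Diffeomorph I' I N M m)
    (hm : m ≠ 0)
    (hiso : ∀ x (v : TangentSpace I' x),
      hM.inner (Φ x) (mfderiv I' I Φ x v) (mfderiv I' I Φ x v) = hN.inner x v v) :
    MeasurePreserving Φ (riemannianMeasure hN) (riemannianMeasure hM) :=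
  ⟨Φ.continuous.measurable, Diffeomorph.map_riemannianMeasure Φ hm hiso⟩

/-- **Change of variables in integrals against the Riemannian measure along an isometric
diffeomorphism**: `∫⁻ f ∘ Φ dV_{h_N} = ∫⁻ f dV_{h_M}` (every `f : M → ℝ≥0∞`).
[cite: Federer1969, §2.10.11] -/
theorem Diffeomorph.lintegral_comp_riemannianMeasure {m : ℕ∞ω} (Φ : Diffeomorph I' I N M m)
    (hm : m ≠ 0)
    (hiso : ∀ x (v : TangentSpace I' x),
      hM.inner (Φ x) (mfderiv I' I Φ x v) (mfderiv I' I Φ x v) = hN.inner x v v)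
    (f : M → ℝ≥0∞) :
    ∫⁻ x, f (Φ x) ∂(riemannianMeasure hN) = ∫⁻ y, f y ∂(riemannianMeasure hM) :=
  (Diffeomorph.measurePreserving_riemannianMeasure Φ hm hiso).lintegral_comp_emb
    Φ.toHomeomorph.measurableEmbedding f

/-- Change of variables over a set: `∫⁻_{Φ⁻¹ A} f ∘ Φ dV_{h_N} = ∫⁻_A f dV_{h_M}`.
[cite: Federer1969, §2.10.11] -/
theorem Diffeomorph.setLIntegral_comp_riemannianMeasure {m : ℕ∞ω} (Φ : Diffeomorph I' I N M m)
    (hm : m ≠ 0)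
    (hiso : ∀ x (v : TangentSpace I' x),
      hM.inner (Φ x) (mfderiv I' I Φ x v) (mfderiv I' I Φ x v) = hN.inner x v v)
    (f : M → ℝ≥0∞) (A : Set M) :
    ∫⁻ x in Φ ⁻¹' A, f (Φ x) ∂(riemannianMeasure hN) = ∫⁻ y in A, f y ∂(riemannianMeasure hM) :=
  (Diffeomorph.measurePreserving_riemannianMeasure Φ hm hiso).setLIntegral_comp_preimage_emb
    Φ.toHomeomorph.measurableEmbedding f A

/-- Change of variables over a set, image form: `∫⁻_s f ∘ Φ dV_{h_N} = ∫⁻_{Φ s} f dV_{h_M}`.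
[cite: Federer1969, §2.10.11] -/
theorem Diffeomorph.setLIntegral_comp_riemannianMeasure' {m : ℕ∞ω} (Φ : Diffeomorph I' I N M m)
    (hm : m ≠ 0)
    (hiso : ∀ x (v : TangentSpace I' x),
      hM.inner (Φ x) (mfderiv I' I Φ x v) (mfderiv I' I Φ x v) = hN.inner x v v)
    (f : M → ℝ≥0∞) (s : Set N) :
    ∫⁻ x in s, f (Φ x) ∂(riemannianMeasure hN) = ∫⁻ y in Φ '' s, f y ∂(riemannianMeasure hM) :=
  (Diffeomorph.measurePreserving_riemannianMeasure Φ hm hiso).setLIntegral_comp_emb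
    Φ.toHomeomorph.measurableEmbedding f s

end Volume

/-! ### In the vocabulary of `Isometry.lean`: isometries of `PseudoRiemannianMetric`s -/

section IsIsometry

namespace PseudoRiemannianMetric

variable [IsManifold I' ∞ N] [IsManifold I ∞ M] {n : ℕ∞ω}
  {gN : PseudoRiemannianMetric I' n E' (TangentSpace I' : N → Type _)}
  {gM : PseudoRiemannianMetric I n E (TangentSpace I : M → Type _)}
  {m : ℕ∞ω} {Φ : Diffeomorph I' I N M m}

/-- An isometry `Φ : (N, gN) → (M, gM)` satisfies `gM(dΦ v, dΦ w) = gN(v, w)` (unfolding of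
`IsIsometry`, O'Neill 1983, Ch. 3, Def. 3.4). [cite: ONeill1983, Ch. 3, Def. 3.4 (p. 58)] -/
theorem IsIsometry.val_mfderiv_mfderiv (hΦ : IsIsometry gN gM Φ) (x : N)
    (v w : TangentSpace I' x) :
    gM.val (Φ x) (mfderiv I' I Φ x v) (mfderiv I' I Φ x w) = gN.val x v w := by
  rw [← pullbackBilin_apply (I := I) (I' := I') Φ gM.val x v w, hΦ x]

/-- The source metric of a `C^m` isometry (`m ≠ 0`) onto a Riemannian manifold is Riemannian
(`gN(v, v) = gM(dΦ v, dΦ v) > 0` for `v ≠ 0`, `dΦ` being injective). [folklore] -/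
theorem IsIsometry.isRiemannian (hΦ : IsIsometry gN gM Φ) (hm : m ≠ 0)
    (hgM : gM.IsRiemannian) : gN.IsRiemannian := by
  intro x v hv
  rw [← hΦ.val_mfderiv_mfderiv x v v]
  refine hgM _ _ fun h0 ↦ hv ((Φ.mfderivToContinuousLinearEquiv hm x).injective ?_)
  rw [map_zero]
  exact h0

variable [FiniteDimensional ℝ E] [FiniteDimensional ℝ E']

/-- **Isometries preserve the Riemannian distance** (`PseudoRiemannianMetric.edist` of
`RiemannianDistance.lean`): `d_{gM}(Φ x, Φ y) = d_{gN}(x, y)`. O'Neill 1983, Ch. 5, Def. 15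
ff.; Lee 2018, Prop. 2.51. [cite: ONeill1983, Ch. 5, Def. 15 (p. 134)] -/
theorem IsIsometry.edist_eq (hΦ : IsIsometry gN gM Φ) (hm : m ≠ 0) (hgN : gN.IsRiemannian)
    (hgM : gM.IsRiemannian) (x y : N) :
    gM.edist hgM (Φ x) (Φ y) = gN.edist hgN x y := by
  letI := gN.riemannianBundle hgN
  letI := gM.riemannianBundle hgM
  have heq : ∀ x (v : TangentSpace I' x), ‖mfderiv I' I Φ x v‖ = ‖v‖ := fun x v ↦ by
    rw [gM.norm_eq_sqrt hgM, gN.norm_eq_sqrt hgN, hΦ.val_mfderiv_mfderiv]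
  exact Diffeomorph.riemannianEDist_eq Φ hm heq x y

variable [T3Space M] [MeasurableSpace M] [BorelSpace M] [T3Space N] [MeasurableSpace N]
  [BorelSpace N]

/-- **Isometries preserve the Riemannian measure** of the Mathlib Riemannian metrics
`g.toContMDiffRiemannianMetric` (to which `g.riemVolume` unfolds, `riemVolume_eq`):
`dV_{gM}(Φ(s)) = dV_{gN}(s)`. Federer 1969, §2.10.11 with §3.2.46. [cite: Federer1969, §2.10.11] -/
theorem IsIsometry.riemannianMeasure_image_eq (hΦ : IsIsometry gN gM Φ) (hm : m ≠ 0)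
    (hgN : gN.IsRiemannian) (hgM : gM.IsRiemannian) (s : Set N) :
    riemannianMeasure (gM.toContMDiffRiemannianMetric hgM) (Φ '' s) =
      riemannianMeasure (gN.toContMDiffRiemannianMetric hgN) s :=
  Diffeomorph.riemannianMeasure_image_eq Φ hm
    (fun x v ↦ by simp only [toContMDiffRiemannianMetric_inner, hΦ.val_mfderiv_mfderiv]) s

/-- **Isometries are measure preserving** for the Riemannian measures of
`g.toContMDiffRiemannianMetric`. [cite: Federer1969, §2.10.11] -/
theorem IsIsometry.measurePreserving_riemannianMeasure (hΦ : IsIsometry gN gM Φ) (hm : m ≠ 0)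
    (hgN : gN.IsRiemannian) (hgM : gM.IsRiemannian) :
    MeasurePreserving Φ (riemannianMeasure (gN.toContMDiffRiemannianMetric hgN))
      (riemannianMeasure (gM.toContMDiffRiemannianMetric hgM)) :=
  Diffeomorph.measurePreserving_riemannianMeasure Φ hm
    fun x v ↦ by simp only [toContMDiffRiemannianMetric_inner, hΦ.val_mfderiv_mfderiv]

end PseudoRiemannianMetric

end IsIsometry

end Literature.Geometry.Lorentzian

end
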